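import Summits.BirchSwinnertonDyer.Rank1Residual.Additive.X3BranchLayerTwoZeta27
import HarnessLib

/-!
# X3, the DEGENERATE rows OFF the sub-locus, T-SIDE OVER THE SECOND LAYER: the THIRD layer group fixes
# `ζ₈₁` up to inversion, and fixes it on the nose on the stabiliser of `ζ₃` (cell `bsd-eis`, seat
# `bsd-eis-x3` gen 8; gen 7's `X3BranchLayerTwoZeta27.lean` one level up — the `ζ₈₁` half of STEP 3
# of the independence argument for the T-side classes over `ℚ_2`, x3-MEMO-10 §5 (f):
# `κ⁻¹(27ℤ₃) ∩ Stab(ζ₃)` fixes `ζ₈₁`, so the layer character of `κ⁻¹(9ℤ₃) ∩ Stab(ζ₃)` is the Kummer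
# character of `ζ₂₇ = ζ₈₁³`; route K1 `AdditiveBranchIMC`, crux `GordTwoRankZeroOffCaseOne` —
# supports only)

HONEST FRAMING (`run/shared/lean/pub/bsd-eis/README.md` §4): THEOREMS ONLY (no `def`, no named fact,
no `sorry`); nothing is booked; no label, tier or count of record moves.

* `toZModPow_four_sq_eq_one` — `σ ∈ κ_cyc⁻¹(27ℤ₃)` ⟹ `χ₃(σ)² ≡ 1 (mod 81)`;
* `smul_eq_or_eq_pow_80` — hence `σζ ∈ {ζ, ζ⁸⁰}` for `ζ⁸¹ = 1`;
* `smul_zeta81_eq_of_smul_pow_27` — if moreover `σ` fixes `ζ²⁷` (a primitive cube root of unity when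
  `ζ` is a primitive `81`-st root of unity) then `σζ = ζ`;
* `smul_zeta81_eq_of_mem_layerSubgroup_three` — the same for every cyclotomic `κ` (unit twists).
References: [Washington1997] §13.1; [Serre1973] Ch. II §3.2.
-/

set_option autoImplicit false

noncomputable section

namespace Summit.BirchSwinnertonDyer.Rank1Residual.Additive

namespace LayerCharTower

open Field IntermediateField
open Literature.NumberTheory.GaloisRepresentations
open Literature.NumberTheory.EllipticCurves Literature.NumberTheory.EllipticCurves.PadicOneUnits
  Literature.NumberTheory.EllipticCurves.CyclotomicZp
open Summit.BirchSwinnertonDyer.Rank1Residual.Iwasawa.CyclotomicLayerOne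

/-- For `σ ∈ κ_cyc⁻¹(27ℤ₃)`: `χ₃(σ)² ≡ 1 (mod 81)`. [cite: Washington1997, §13.1]
[cite: Serre1973, Ch. II §3.2 Prop. 8] -/
theorem toZModPow_four_sq_eq_one {σ : absoluteGaloisGroup ℚ}
    (hσ : σ ∈ (zpExtension 3).layerSubgroup 3) :
    (PadicInt.toZModPow 4 ((GaloisRep.cyclotomicCharacter ℚ 3 σ : ℤ_[3]ˣ) : ℤ_[3])) ^ 2 = 1 := by
  set u : ℤ_[3]ˣ := GaloisRep.cyclotomicCharacter ℚ 3 σ with hu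
  -- `27 ∣ ℓ(u)`
  rw [ZpExtension.mem_layerSubgroup, zpExtension_apply, toAdd_ofAdd] at hσ
  obtain ⟨y, hy⟩ := hσ
  have ht : torsionOrder 3 = 2 := by
    rw [torsionOrder, cyclotomicExponent, if_neg (by decide), pow_one, Nat.totient_prime (by norm_num)]
  have he : cyclotomicExponent 3 - 1 = 0 := by rw [cyclotomicExponent, if_neg (by decide)]
  have h1 : cycPow 3 (torsionOrder 3 * ell 3 u) = (u : ℤ_[3]) ^ 2 := by
    rw [cycPow_torsionOrder_mul_ell, ht]
  have h2 : ‖cycPow 3 (torsionOrder 3 * ell 3 u) - 1‖ =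
      ‖(torsionOrder 3 : ℤ_[3]) * ell 3 u‖ * ‖(3 : ℤ_[3]) ^ (0 + 1)‖ := by
    have := norm_oneAddPow_sub_one (p := 3) 0 (by norm_num) ((torsionOrder 3 : ℤ_[3]) * ell 3 u)
    rw [cycPow, he]
    exact this
  rw [h1, ht, hy, zero_add, pow_one] at h2
  -- hence `‖u² − 1‖ ≤ ‖81‖`
  have h3 : ‖(u : ℤ_[3]) ^ 2 - 1‖ ≤ ‖(3 : ℤ_[3]) ^ 4‖ := by
    rw [h2, show (3 : ℤ_[3]) ^ 4 = 3 ^ 3 * 3 by ring, norm_mul ((3 : ℤ_[3]) ^ 3)]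
    refine mul_le_mul_of_nonneg_right ?_ (norm_nonneg _)
    calc ‖((2 : ℕ) : ℤ_[3]) * ((3 : ℤ_[3]) ^ 3 * y)‖
        = ‖((2 : ℕ) : ℤ_[3])‖ * (‖(3 : ℤ_[3]) ^ 3‖ * ‖y‖) := by rw [norm_mul, norm_mul]
      _ ≤ 1 * (‖(3 : ℤ_[3]) ^ 3‖ * 1) := by
          gcongr
          · exact PadicInt.norm_le_one _
          · exact PadicInt.norm_le_one _
      _ = ‖(3 : ℤ_[3]) ^ 3‖ := by ring
  have h4 : (u : ℤ_[3]) ^ 2 - 1 ∈ Ideal.span {((3 : ℕ) : ℤ_[3]) ^ 4} := by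
    rw [← PadicInt.norm_le_pow_iff_mem_span_pow]
    have hp : ‖(3 : ℤ_[3])‖ = ((3 : ℕ) : ℝ)⁻¹ := PadicInt.norm_p
    refine h3.trans (le_of_eq ?_)
    rw [norm_pow, hp, zpow_neg, zpow_natCast, inv_pow]
  rw [← PadicInt.ker_toZModPow, RingHom.mem_ker, map_sub, map_pow, map_one, sub_eq_zero] at h4
  exact h4

/-- Square roots of `1` in `ℤ/81`: `x² = 1 ⇒ x = 1 ∨ x = 80`. [folklore] -/
theorem zmod81_sq_eq_one {x : ZMod 81} (hx : x ^ 2 = 1) : x = 1 ∨ x = 80 := by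
  revert x hx; decide

/-- For `σ ∈ κ_cyc⁻¹(27ℤ₃)` and `ζ⁸¹ = 1` in `ℚ̄`: `σζ = ζ` or `σζ = ζ⁸⁰`. [cite: Washington1997, §13.1] -/
theorem smul_eq_or_eq_pow_80 {σ : absoluteGaloisGroup ℚ} (hσ : σ ∈ (zpExtension 3).layerSubgroup 3)
    (ζ : AlgebraicClosure ℚ) (hζ : ζ ^ 81 = 1) : σ • ζ = ζ ∨ σ • ζ = ζ ^ 80 := by
  haveI : NeZero ((3 : ℕ) : ℚ) := ⟨by norm_num⟩
  have hspec := GaloisRep.cyclotomicCharacter_spec ℚ 3 (k := 4) σ ζ (by simpa using hζ)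
  rcases zmod81_sq_eq_one (toZModPow_four_sq_eq_one hσ) with h | h
  · left
    rw [hspec]
    have : (PadicInt.toZModPow 4 ((GaloisRep.cyclotomicCharacter ℚ 3 σ : ℤ_[3]ˣ) : ℤ_[3])).val = 1 := by
      rw [h]; decide
    rw [this, pow_one]
  · right
    rw [hspec]
    have : (PadicInt.toZModPow 4 ((GaloisRep.cyclotomicCharacter ℚ 3 σ : ℤ_[3]ˣ) : ℤ_[3])).val = 80 := by
      rw [h]; decide
    rw [this]

/-- **`κ_cyc⁻¹(27ℤ₃) ∩ Stab(ζ₃)` fixes `ζ₈₁`**: for a primitive `81`-st root of unity `ζ` and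
`σ ∈ κ_cyc⁻¹(27ℤ₃)` with `σζ²⁷ = ζ²⁷`, `σζ = ζ` (the alternative `σζ = ζ⁸⁰` would give
`σζ²⁷ = ζ²¹⁶⁰ = ζ⁵⁴ ≠ ζ²⁷`). [cite: Washington1997, §13.1] -/
theorem smul_zeta81_eq_of_smul_pow_27 {σ : absoluteGaloisGroup ℚ}
    (hσ : σ ∈ (zpExtension 3).layerSubgroup 3) {ζ : AlgebraicClosure ℚ} (hζ : IsPrimitiveRoot ζ 81)
    (h27 : σ • ζ ^ 27 = ζ ^ 27) : σ • ζ = ζ := by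
  rcases smul_eq_or_eq_pow_80 hσ ζ hζ.pow_eq_one with h | h
  · exact h
  · exfalso
    rw [smul_pow', h, ← pow_mul, show 80 * 27 = 81 * 26 + 54 from rfl, pow_add, pow_mul,
      hζ.pow_eq_one, one_pow, one_mul] at h27
    -- `ζ⁵⁴ = ζ²⁷` forces `ζ²⁷ = 1`
    have h0 : ζ ^ 27 ≠ 0 := pow_ne_zero 27 (hζ.ne_zero (by norm_num))
    have h1 : ζ ^ 27 * ζ ^ 27 = 1 * ζ ^ 27 := by rw [← pow_add, one_mul]; exact h27
    have h271 : ζ ^ 27 = 1 := mul_right_cancel₀ h0 h1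
    exact (hζ.pow_ne_one_of_pos_of_lt (by norm_num) (by norm_num)) h271

/-- **Every cyclotomic `κ`**: for `σ ∈ κ.layerSubgroup 3` (`κ` cyclotomic) fixing `ζ₈₁²⁷`, `σ` fixes the
primitive `81`-st root of unity `ζ₈₁` (`κ` is a unit twist of `κ_cyc`, same layer subgroups).
[cite: Washington1997, §13.1] -/
theorem smul_zeta81_eq_of_mem_layerSubgroup_three {κ : ZpExtension ℚ 3} (hκ : κ.IsCyclotomic)
    {σ : absoluteGaloisGroup ℚ} (hσ : σ ∈ κ.layerSubgroup 3) {ζ : AlgebraicClosure ℚ}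
    (hζ : IsPrimitiveRoot ζ 81) (h27 : σ • ζ ^ 27 = ζ ^ 27) : σ • ζ = ζ := by
  obtain ⟨u, rfl⟩ := ZpExtension.IsCyclotomic.exists_eq_unitTwist_holds (isCyclotomic_zpExtension 3) hκ
  rw [ZpExtension.layerSubgroup_unitTwist] at hσ
  exact smul_zeta81_eq_of_smul_pow_27 hσ hζ h27

end LayerCharTower

end Summit.BirchSwinnertonDyer.Rank1Residual.Additive

end
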